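import Summits.CriticalPhenomena.Ising3DConformalLimit.Theorems.PlantedPinningGaussianPinningSaturationDefs
import Summits.CriticalPhenomena.Ising3DConformalLimit.Theorems.PlantedPinningGaussianPinningSaturationStructure
import Summits.CriticalPhenomena.Ising3DConformalLimit.Theorems.PlantedPinningGaussianPinningSaturationVarianceSplit
import Summits.CriticalPhenomena.Ising3DConformalLimit.Theorems.PlantedPinningGaussianPinningSaturationLinEffLeOne
import Summits.CriticalPhenomena.Ising3DConformalLimit.Theorems.PlantedPinningGaussianPinningSaturationBoxSusceptibilityFloor
import Summits.CriticalPhenomena.Ising3DConformalLimit.Theorems.PlantedPinningGaussianPinningSaturationTwoPointReduction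
import Summits.CriticalPhenomena.Ising3DConformalLimit.Theorems.PlantedPinningGaussianPinningSaturationLatticeDecomposition

/-!
# Skeleton of line `birth` (linear-benchmark split) for crux `GaussianPinningSaturation`
(stmt-CriticalPhenomena-8452) — lead seat c1 (`prover-line-stmt-CriticalPhenomena-8452-c1-0`)

Route `PlantedPinning` (route-CriticalPhenomena-PlantedPinning), sub-problem `Ising3DConformalLimit`,
crux r3 `Summit.CriticalPhenomena.Ising3DConformalLimit.Theses.PlantedPinning.GaussianPinningSaturation`.

Reshape history:
* v0 (registrar `planner-skel-stmt-CriticalPhenomena-8452-0`, sha 0f26905c): vocabulary inlined.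
* v1 (lead c1, 2026-08-17): vocabulary, the three stub currencies and the composition certificate
  LANDED as `Theorems/PlantedPinningGaussianPinningSaturationDefs.lean` (p143350); this file now
  imports them, so the stub signatures below are verbatim the registered ones with every short name
  resolving to the landed `…PlantedPinningGaussianPinningSaturation.*` objects. Stub set unchanged:
  A `stub_varianceSplit` (identity, provable now), B `stub_twoPointSaturation` (two-point level),
  C `stub_gaussianLinearisesRegression` (load-bearing conditional CLT).
* v2 (lead c1, 2026-08-17T08:00Z): stub A LANDED (`…VarianceSplit.stub_varianceSplit`, p145459) and is
  now IMPORTED (its `sorry` is gone); structure file landed (p144075: `gapEff ≥ 0`, lossless split,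
  vacuous payer `stub_cruxOfR4NonGaussian : IsingEuclidUpgradeR4NonGaussian → crux`); Gaussian ceiling
  `stub_linEffLeOne : linEff ≤ 1` landed (p147203). Open stubs: B, C (2 sorries).
* v3 (lead c1, 2026-08-17T09:30Z): stub B RESHAPED along the exact Riccati bookkeeping of the linear
  flow `v_j = linVar L j` (currencies appended to the Defs file, p148394):
  B ⟸ B1 `stub_boxSusceptibilityFloor` (the `+` box susceptibility diverges; LANDED p149829, worker)
    ∧ B2 `stub_linRiccatiSaturation` (LOAD-BEARING kernel statement: `v_0 ≤ v_k(1 + (1+ε)A v_0)`,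
       i.e. the averaged Riccati slack of the random Schur complements of the critical covariance
       vanishes; open — for the lattice GFF it is the Bernoulli-trapping/range LLN),
  glue `twoPointSaturation_of_floor_of_riccati` LANDED (…TwoPointReduction.lean, p150452).
  Open stubs: B2, C (2 sorries). `stub_boxCovTendsto` (thermodynamic limit of the box covariance)
  is a registered support currency for B2/C work, not used by the composition.

* v4 (lead c2, `prover-line-stmt-CriticalPhenomena-8452-c2-0`, 2026-08-17T11:45Z, cycle 2): stub set UNCHANGED
  {B2, C}. Logical position of the crux LANDED (`Theorems/PlantedPinningGaussianPinningSaturationLogic.lean`,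
  p157283; append p157892): the crux's conclusion is `S`-free, so crux ⟺ (∃ hypothesis block → lattice
  saturation); the block is satisfiable by `gffLattice (3/5)` (model-blind crux ⟺ unconditional lattice
  saturation, refuted by the route's own r2 `PinningEfficiencyDeficit`); and UNDER r2 THE CRUX IS EQUIVALENT TO
  ITEM 0636 `IsingEuclidUpgradeR4NonGaussian` VERBATIM (`gaussianPinningSaturation_iff_R4NonGaussian`, via the
  landed `exists_moebius_normalisation_of_gaussian`). Wave 1: stub-worker on C → `stub-blocked: 0636` (tree scan:
  every `criticalCorr 3 … → HasNontrivialU4` theorem is conditional on an open item). So C cannot close before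
  0636, and with 0636 the crux closes WITHOUT this line (`gaussianPinningSaturation_of_R4NonGaussian`); B2 stays a
  true-looking, hypothesis-free, research-level kernel statement (dilute crushed-ice homogenisation), tested
  numerically by kit jobs j025672 (exact e^lin: GFF / power-law kernels), j025673 (torus planted MC: e, e^lin,
  e^gap), j025702 (`+` box e).

* v5 (lead c2, 2026-08-17T14:00Z, cycle 2): HONEST COMPANION STUB added. The scaling-limit hypotheses of C are
  idle (model-blind, `hypothesisBlock_satisfiable`) and C's vacuous payer is exactly item 0636
  (`gaussianPinningSaturation_iff_R4NonGaussian_or_lin_and_gap`, landed …LatticeDecomposition.lean: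
  crux ⟺ 0636 ∨ (e^{lin} → 1 ∧ e^{gap} → 0), hypothesis-free). So the line now carries the lattice content of C
  as its own registered stub G `stub_latticeGapVanishing` (`e^{gap} → 0`, NO hypotheses: the planted regression
  of the critical `+` boxes is asymptotically linear — numerically testable, kit job j025673; believed FALSE at an
  interacting fixed point, i.e. it is the route's r2 in disguise given B2: `not_gapVanishing_of_deficit_of_riccati`),
  with the second sorry-free composition `GaussianPinningSaturation_of_latticeStubs` (crux ⇐ B2 ∧ G, by the landed
  `gaussianPinningSaturation_of_riccati_of_gap`). Stub set {B2, C, G}; C stays registered as the 0636-blocked form.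

The line: for any square-integrable vector the planted conditional variance splits EXACTLY (law of
total variance + `L²`-orthogonality of the regression onto the affine span of the pinned spins):
`E⁺[Var(M | σ_P)] = R_L(P) − N_L(P)` with `R_L(P) = Var⁺(M) − C_{M,P}(G_{PP})⁻¹C_{P,M}` the LINEAR
(value-blind, two-point-only) residual (`linResidual`) and `N_L(P) = E⁺[(E[M|σ_P] − Lin_P)²] ≥ 0` the
NONLINEAR regression gap (`regressionGap`). Hence `e = e^{lin} − e^{gap}`
(`plantedEff_eq_linEff_sub_gapEff`, landed) and the crux follows from A (the split), B (the linear
efficiency saturates under the two-point hypotheses) and C (a Gaussian limit linearises the planted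
regression) by `gaussianPinningSaturation_of_split` (landed, = bookkeeping stub `stub_splitCertificate`).

Hardest stub: C. Disproof used: none (no `Cruxes/GaussianPinningSaturation/Disproof.lean` exists,
2026-08-17T05:30Z). Dead lines: none recorded for this crux.
-/

open scoped BigOperators Classical
open Finset MeasureTheory
open Literature.Probability.LatticeModels
open Summit.CriticalPhenomena.Ising3DConformalLimit.PlantedPinningGaussianPinningSaturation

noncomputable section

namespace Summit.CriticalPhenomena.Ising3DConformalLimit.Cruxes.GaussianPinningSaturation.Birth

/-! ### Registered stubs (the ONLY `sorry`s of this file: B2 and C) -/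

/-! STUB A `stub_varianceSplit` is LANDED: `Summit.CriticalPhenomena.Ising3DConformalLimit.
PlantedPinningGaussianPinningSaturation.stub_varianceSplit` (Theorems/…VarianceSplit.lean, p145459),
imported above and used by name in the composition below. -/

/-- STUB B2 (OPEN, LOAD-BEARING for B) — `LinRiccatiSaturation`: for every `ε > 0`, for `p` small
and `L ≥ L₀(p)`, with `n = |Λ_L|`, `k = ⌈pn⌉`, `v_j = linVar L j` (average over `j`-subsets `P` of the
linear residual `R_L(P)`) and `A = k/((n+1)(n−k+1))`:  `v_0 ≤ v_k · (1 + (1+ε)·A·v_0)`, i.e.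
`1/v_k − 1/v_0 ≤ (1+ε)A` — the telescoped Gaussian Riccati flow `1/v_{j+1} − 1/v_j = (1+s_j)θ_j/(n−j)²`
has weighted-average slack `≤ ε`. The slack `s_j ≥ 0` vanishes iff (a) the linear residual single-spin
variance `(G/G_{PP})_{zz} → 1`, (b) the linear conditional susceptibility `χ_P(z) = Σ_y (G/G_{PP})_{zy}`
is asymptotically constant over unpinned `z` (Cauchy–Schwarz), (c) `R_L(P)` concentrates over `P`
(Jensen). Why plausibly true: at pin density `p → 0` the screening length `L*(p) ≍ p^{-1/(3−2Δ)}`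
diverges and `≍ p·L*³ → ∞` pins sit in a screening ball, so (b),(c) are laws of large numbers and (a)
is `p Σ_{|x|≤L*} G(0,x)² → 0`; for MARKOV kernels (lattice GFF, `G/G_{PP}` = Green kernel killed on
`P`) this is Bernoulli trapping: `E#{sites visited before absorption} = 1/p` exactly, range LLN,
Donsker–Varadhan tails lower order. Why it might fail: the critical Ising kernel is not Markov
(`(cov L)_{PP}⁻¹` has no sign structure / walk representation; cf. crux `InverseMFerromagnet`); early
steps `j ≲ L` are unscreened with `O(1)` slack (harmless: weight `≍ 1/(pL²)`), but a `p`-uniform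
`O(1)` slack at density `≍ p` would give a plateau `e^{lin}_* < 1` and kill B (numerical test: lead's
kit job j024018, exact linear algebra for the GFF / `|x|^{-1.036}` / `|x|^{-1}` kernels). The two-point
scaling-limit hypotheses of B can only enter here (regular variation of the kernel,
`two_point_ratio_asymptotics`). -/
theorem stub_linRiccatiSaturation :
    ∀ ε : ℝ, 0 < ε → ∃ p₀ : ℝ, 0 < p₀ ∧ ∀ p : ℝ, 0 < p → p < p₀ → ∃ L₀ : ℕ, ∀ L ≥ L₀,
      linVar L 0 ≤ linVar L ⌈p * ((box 3 L).card : ℝ)⌉₊ *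
        (1 + (1 + ε) * effOf L ⌈p * ((box 3 L).card : ℝ)⌉₊ (linVar L 0)) := by
  sorry

/-- STUB B `stub_twoPointSaturation` DERIVED (no `sorry` of its own): B ⟸ B1 (landed
`stub_boxSusceptibilityFloor`, p149829) ∧ B2 (`stub_linRiccatiSaturation` above) by the landed glue
`twoPointSaturation_of_floor_of_riccati` (p150452). The scaling-limit hypotheses are not used by the
glue. -/
theorem stub_twoPointSaturation :
    ∀ (ρ : ℝ → ℝ) (Δ : ℝ) (S : CorrFamily 3), (∀ δ ∈ Set.Ioc (0:ℝ) 1, 0 < ρ δ) → 0 < Δ →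
      HasPointwiseScalingLimit (criticalCorr 3) ρ S → IsNondegenerateTwoPoint S →
      IsMoebiusCovariant Δ S →
      ∀ ε : ℝ, 0 < ε → ∃ p₀ : ℝ, 0 < p₀ ∧ ∀ p : ℝ, 0 < p → p < p₀ → ∃ L₀ : ℕ, ∀ L ≥ L₀,
        1 - ε ≤ linEff L ⌈p * ((box 3 L).card : ℝ)⌉₊ :=
  twoPointSaturation_of_floor_of_riccati
    Summit.CriticalPhenomena.Ising3DConformalLimit.PlantedPinningGaussianPinningSaturation.stub_boxSusceptibilityFloor
    stub_linRiccatiSaturation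

/-- STUB C (XL, OPEN, LOAD-BEARING) — `GaussianLinearisesRegression`: under the crux hypotheses
(non-degenerate Möbius pointwise limit `(ρ,Δ,S)` of `criticalCorr 3` with `U₄ ≡ 0` off coincidences),
for every `ε > 0`, for `p` small and `L ≥ L₀(p)`, `e^{gap}_L(⌈p|Λ_L|⌉) ≤ ε`, i.e.
`p·χ_N(p) → 0` where `χ_N` is the "nonlinear regression susceptibility"
`n⁻¹·E⁺(E[M_L|σ_P] − Lin_P)²`: the planted regression is asymptotically linear. Mechanism to prove:
a conditional CLT — vanishing `U₄` of the limit (`U₄` dominates all higher truncations lattice-side: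
`newman_gaussian_evenMoment_le_holds`, `corrIn_le_pairingSum`) forces the regression of a spin at
distance `≍ L*(p) → ∞` from the pins onto the pinned spins to be linear to leading order, uniformly
over typical planted `P`. Why it might fail: conditioning on exact lattice values `σ_x = ±1` is a
lattice-scale operation that pointwise `n`-point limits may not control (the crux's own risk); a
`Δ > 1/2` generalised-free limit has no `±1` lattice model to test against. Vacuous route: item 0636
`IsingEuclidUpgradeR4NonGaussian` contradicts the hypotheses and gives C (and the crux) outright. -/
theorem stub_gaussianLinearisesRegression :
    ∀ (ρ : ℝ → ℝ) (Δ : ℝ) (S : CorrFamily 3), (∀ δ ∈ Set.Ioc (0:ℝ) 1, 0 < ρ δ) → 0 < Δ →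
      HasPointwiseScalingLimit (criticalCorr 3) ρ S → IsNondegenerateTwoPoint S →
      IsMoebiusCovariant Δ S → ¬ HasNontrivialU4 S →
      ∀ ε : ℝ, 0 < ε → ∃ p₀ : ℝ, 0 < p₀ ∧ ∀ p : ℝ, 0 < p → p < p₀ → ∃ L₀ : ℕ, ∀ L ≥ L₀,
        gapEff L ⌈p * ((box 3 L).card : ℝ)⌉₊ ≤ ε := by
  sorry

/-- STUB G (OPEN, hypothesis-free companion of C, lead c2) — `LatticeGapVanishing`: the planted regression of the
critical `+` boxes is asymptotically LINEAR — for every `ε > 0`, for `p` small and `L ≥ L₀(p)`,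
`e^{gap}_L(⌈p|Λ_L|⌉) ≤ ε`, where `e^{gap} = A·E_P E⁺[(E[M_L|σ_P] − Lin_P(σ_P))²] ≥ 0` is the normalised nonlinear
regression gap (`gapEff`, Defs). This is the lattice content of stub C with its idle scaling-limit hypotheses
dropped; with B2 it proves the crux (`gaussianPinningSaturation_of_riccati_of_gap`, landed), and under the route's
r2 and B2 it is FALSE (`not_gapVanishing_of_deficit_of_riccati`, landed): `1 − e*` is then carried entirely by the
nonlinear part of the planted regression (physical picture: at the screening scale `L*(p)` the planted signal in
the pins, block spin `≍ L*^{−Δ}`, equals the pin sampling noise `(pL*³)^{−1/2}` by definition of `L*`, so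
`E[M_B | pins]` is a posterior mean at signal/noise `≍ 1` under the critical block-spin prior — linear iff that
prior is Gaussian). Numerical test: kit job j025673 (direct, noise-debiased `e^{gap}` on `L ≤ 48` tori). -/
theorem stub_latticeGapVanishing :
    ∀ ε : ℝ, 0 < ε → ∃ p₀ : ℝ, 0 < p₀ ∧ ∀ p : ℝ, 0 < p → p < p₀ → ∃ L₀ : ℕ, ∀ L ≥ L₀,
      gapEff L ⌈p * ((box 3 L).card : ℝ)⌉₊ ≤ ε := by
  sorry

/-! ### Name-keyed aliases of the stub statements (the hypotheses of the composition) -/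
namespace Registered

/-- Alias of `VarianceSplit` keyed by the registered stub name. -/
abbrev stub_varianceSplit : Prop := VarianceSplit
/-- Alias of `TwoPointSaturation` keyed by the registered stub name. -/
abbrev stub_twoPointSaturation : Prop := TwoPointSaturation
/-- Alias of `GaussianLinearisesRegression` keyed by the registered stub name. -/
abbrev stub_gaussianLinearisesRegression : Prop := GaussianLinearisesRegression

end Registered

/-! ### The composition: the three stubs imply the crux BY NAME (landed certificate, no `sorry`) -/

/-- `GaussianPinningSaturation` from STUBS A, B, C (the landed composition certificate
`gaussianPinningSaturation_of_split`: `e = e^{lin} − e^{gap} ≥ (1 − ε/2) − ε/2`). -/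
theorem GaussianPinningSaturation_of (hA : Registered.stub_varianceSplit)
    (hB : Registered.stub_twoPointSaturation) (hC : Registered.stub_gaussianLinearisesRegression) :
    Summit.CriticalPhenomena.Ising3DConformalLimit.Theses.PlantedPinning.GaussianPinningSaturation :=
  gaussianPinningSaturation_of_split hA hB hC

/-- Same composition keyed by the registered stubs: the crux modulo exactly the two remaining
`sorry`s (B2 inside the derived B, and C); stub A enters as the LANDED theorem `stub_varianceSplit`
(p145459), B1 as the LANDED `stub_boxSusceptibilityFloor` (p149829). -/
theorem GaussianPinningSaturation_of_stubs :
    Summit.CriticalPhenomena.Ising3DConformalLimit.Theses.PlantedPinning.GaussianPinningSaturation :=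
  GaussianPinningSaturation_of
    Summit.CriticalPhenomena.Ising3DConformalLimit.PlantedPinningGaussianPinningSaturation.stub_varianceSplit
    stub_twoPointSaturation stub_gaussianLinearisesRegression

/-- **Second composition (lead c2, hypothesis-free):** the crux from the registered stubs B2
(`stub_linRiccatiSaturation`) and G (`stub_latticeGapVanishing`) alone, by the landed
`gaussianPinningSaturation_of_riccati_of_gap` (B1, stub A and the ceiling are landed theorems inside it). -/
theorem GaussianPinningSaturation_of_latticeStubs :
    Summit.CriticalPhenomena.Ising3DConformalLimit.Theses.PlantedPinning.GaussianPinningSaturation :=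
  gaussianPinningSaturation_of_riccati_of_gap stub_linRiccatiSaturation stub_latticeGapVanishing

end Summit.CriticalPhenomena.Ising3DConformalLimit.Cruxes.GaussianPinningSaturation.Birth

end
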